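import Literature.Probability.LatticeModels.DomainDiscretisation
import Literature.Probability.LatticeModels.LatticeLaplacian
import HarnessLib

/-!
# From per-edge bounds to a Lipschitz bound for lattice functions on a ball

Topic `Literature/Probability/LatticeModels` (discrete-to-continuum toolkit for lattice-harmonic
functions; input of the compactness lemma `LatticeSubsequenceLimit.lean` on the discharge path of
`Kenyon2000_flatEdgePoissonKernelLimit`). The interior gradient estimate of `BoxDirichlet.lean`
bounds ONE lattice step, `‖g(u + e_k) - g(u)‖ ≤ L δ`, for the sites `u` whose mesh point
`meshPoint δ u = δ u ∈ ℂ` lies in a closed ball `B̄(z₀, r)`. PROVED here: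

* `norm_sub_le_mul_of_steps` — along a straight lattice segment of `m` steps inside the region the
  bound adds up to `m L δ`;
* **`norm_sub_le_of_latticeLipschitz`** — for two sites `v, w` with mesh points in the ball of
  HALF the radius, `‖g v - g w‖ ≤ 2 L · dist (δ v, δ w)`: the `L`-shaped lattice path from `v` to
  `w` through the corner `(w₀, v₁)` stays in `B̄(z₀, r)` (its mesh points satisfy
  `|p - z₀|² ≤ r²/4 + r²/4`), and `δ(|v₀ - w₀| + |v₁ - w₁|) ≤ 2 dist (δ v, δ w)`.

So a family of lattice functions with per-edge bounds `L δ` is genuinely `2L`-Lipschitz at all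
scales above the mesh, which is the equicontinuity fed into the Arzelà–Ascoli extraction.
Everything is proved, [folklore]; no named fact.
-/

noncomputable section

namespace Literature.Probability.LatticeModels

open Metric

variable {E : Type*} [SeminormedAddCommGroup E]

/-! ### Straight segments -/

/-- **Steps add up.** If every site `u + j e_k`, `j < m`, satisfies the per-edge bound
`‖g (· + e_k) - g ·‖ ≤ L δ`, then `‖g (u + m e_k) - g u‖ ≤ m L δ`. [folklore] -/
theorem norm_sub_le_mul_of_steps {g : Site 2 → E} {L δ : ℝ} (u : Site 2) (k : Fin 4) (m : ℕ)
    (h : ∀ j : ℕ, j < m → ‖g (u + j • cornerUnit k + cornerUnit k) - g (u + j • cornerUnit k)‖ ≤ L * δ) :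
    ‖g (u + m • cornerUnit k) - g u‖ ≤ m * (L * δ) := by
  induction m with
  | zero => simp
  | succ n ih =>
    have h1 := ih fun j hj => h j (by omega)
    have h2 := h n (by omega)
    calc ‖g (u + (n + 1) • cornerUnit k) - g u‖
        = ‖(g (u + n • cornerUnit k + cornerUnit k) - g (u + n • cornerUnit k)) +
            (g (u + n • cornerUnit k) - g u)‖ := by rw [succ_nsmul, ← add_assoc]; abel_nf
      _ ≤ ‖g (u + n • cornerUnit k + cornerUnit k) - g (u + n • cornerUnit k)‖ +
            ‖g (u + n • cornerUnit k) - g u‖ := norm_add_le _ _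
      _ ≤ L * δ + n * (L * δ) := add_le_add h2 h1
      _ = (n + 1 : ℕ) * (L * δ) := by push_cast; ring

/-! ### Mesh points of the `L`-shaped path stay in the ball -/

/-- One-dimensional convexity: `(x - a)² ≤ max ((p - a)²) ((q - a)²)` for `x` between `p` and `q`.
[folklore] -/
theorem sq_sub_le_max_of_mem {x p q a : ℝ} (h1 : min p q ≤ x) (h2 : x ≤ max p q) :
    (x - a) ^ 2 ≤ max ((p - a) ^ 2) ((q - a) ^ 2) := by
  rcases le_total p q with hpq | hpq
  · rw [min_eq_left hpq] at h1
    rw [max_eq_right hpq] at h2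
    rcases le_total a x with hax | hax
    · exact le_max_of_le_right (by nlinarith)
    · exact le_max_of_le_left (by nlinarith)
  · rw [min_eq_right hpq] at h1
    rw [max_eq_left hpq] at h2
    rcases le_total a x with hax | hax
    · exact le_max_of_le_left (by nlinarith)
    · exact le_max_of_le_right (by nlinarith)

/-- The squared distance of a mesh point to `z₀` in coordinates. [folklore] -/
theorem dist_meshPoint_sq (δ : ℝ) (u : Site 2) (z₀ : ℂ) :
    dist (meshPoint δ u) z₀ ^ 2 = (δ * u 0 - z₀.re) ^ 2 + (δ * u 1 - z₀.im) ^ 2 := by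
  rw [Complex.dist_eq, Complex.sq_norm, Complex.normSq_apply, Complex.sub_re, Complex.sub_im,
    meshPoint_re, meshPoint_im]
  ring

/-- **A site of the bounding box of `v, w` has its mesh point in `B̄(z₀, r)`** when the mesh points
of `v` and `w` lie in `B̄(z₀, r/2)`: if `u₀` is between `v₀, w₀` and `u₁` between `v₁, w₁` then
`|δu - z₀|² ≤ r²/4 + r²/4 ≤ r²`. [folklore] -/
theorem meshPoint_mem_closedBall_of_between {δ r : ℝ} {z₀ : ℂ} {v w u : Site 2}
    (hv : meshPoint δ v ∈ closedBall z₀ (r / 2)) (hw : meshPoint δ w ∈ closedBall z₀ (r / 2))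
    (h0 : min (v 0) (w 0) ≤ u 0) (h0' : u 0 ≤ max (v 0) (w 0))
    (h1 : min (v 1) (w 1) ≤ u 1) (h1' : u 1 ≤ max (v 1) (w 1)) (hδ : 0 ≤ δ) :
    meshPoint δ u ∈ closedBall z₀ r := by
  rw [mem_closedBall] at hv hw ⊢
  have hr : 0 ≤ r := by linarith [dist_nonneg (x := meshPoint δ v) (y := z₀)]
  have hv2 := dist_meshPoint_sq δ v z₀
  have hw2 := dist_meshPoint_sq δ w z₀
  have hu2 := dist_meshPoint_sq δ u z₀
  have hvsq : dist (meshPoint δ v) z₀ ^ 2 ≤ (r / 2) ^ 2 := by gcongr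
  have hwsq : dist (meshPoint δ w) z₀ ^ 2 ≤ (r / 2) ^ 2 := by gcongr
  -- the two coordinates of `δ u` are between those of `δ v`, `δ w`
  have hx : (δ * u 0 - z₀.re) ^ 2 ≤ max ((δ * v 0 - z₀.re) ^ 2) ((δ * w 0 - z₀.re) ^ 2) := by
    refine sq_sub_le_max_of_mem ?_ ?_
    · rcases le_total (v 0) (w 0) with h | h
      · rw [min_eq_left h] at h0
        have : (δ * v 0 : ℝ) ≤ δ * u 0 := by
          exact mul_le_mul_of_nonneg_left (by exact_mod_cast h0) hδ
        exact min_le_of_left_le this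
      · rw [min_eq_right h] at h0
        have : (δ * w 0 : ℝ) ≤ δ * u 0 := by
          exact mul_le_mul_of_nonneg_left (by exact_mod_cast h0) hδ
        exact min_le_of_right_le this
    · rcases le_total (v 0) (w 0) with h | h
      · rw [max_eq_right h] at h0'
        have : (δ * u 0 : ℝ) ≤ δ * w 0 := by
          exact mul_le_mul_of_nonneg_left (by exact_mod_cast h0') hδ
        exact le_max_of_le_right this
      · rw [max_eq_left h] at h0'
        have : (δ * u 0 : ℝ) ≤ δ * v 0 := by
          exact mul_le_mul_of_nonneg_left (by exact_mod_cast h0') hδ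
        exact le_max_of_le_left this
  have hy : (δ * u 1 - z₀.im) ^ 2 ≤ max ((δ * v 1 - z₀.im) ^ 2) ((δ * w 1 - z₀.im) ^ 2) := by
    refine sq_sub_le_max_of_mem ?_ ?_
    · rcases le_total (v 1) (w 1) with h | h
      · rw [min_eq_left h] at h1
        have : (δ * v 1 : ℝ) ≤ δ * u 1 := by
          exact mul_le_mul_of_nonneg_left (by exact_mod_cast h1) hδ
        exact min_le_of_left_le this
      · rw [min_eq_right h] at h1
        have : (δ * w 1 : ℝ) ≤ δ * u 1 := by
          exact mul_le_mul_of_nonneg_left (by exact_mod_cast h1) hδ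
        exact min_le_of_right_le this
    · rcases le_total (v 1) (w 1) with h | h
      · rw [max_eq_right h] at h1'
        have : (δ * u 1 : ℝ) ≤ δ * w 1 := by
          exact mul_le_mul_of_nonneg_left (by exact_mod_cast h1') hδ
        exact le_max_of_le_right this
      · rw [max_eq_left h] at h1'
        have : (δ * u 1 : ℝ) ≤ δ * v 1 := by
          exact mul_le_mul_of_nonneg_left (by exact_mod_cast h1') hδ
        exact le_max_of_le_left this
  have hxx : (δ * u 0 - z₀.re) ^ 2 ≤ (r / 2) ^ 2 := by
    refine hx.trans (max_le ?_ ?_) <;> nlinarith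
  have hyy : (δ * u 1 - z₀.im) ^ 2 ≤ (r / 2) ^ 2 := by
    refine hy.trans (max_le ?_ ?_) <;> nlinarith
  have hsq : dist (meshPoint δ u) z₀ ^ 2 ≤ r ^ 2 := by nlinarith
  exact (pow_le_pow_iff_left₀ dist_nonneg hr two_ne_zero).1 hsq

/-! ### The Lipschitz bound -/

/-- `v + m e₀` in coordinates. [folklore] -/
theorem add_nsmul_cornerUnit_zero_eq (v : Site 2) (m : ℕ) :
    v + m • cornerUnit 0 = ![v 0 + m, v 1] := by
  ext i; fin_cases i <;> simp [cornerUnit, nsmul_eq_mul]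

/-- `v + m e₁` in coordinates. [folklore] -/
theorem add_nsmul_cornerUnit_one_eq (v : Site 2) (m : ℕ) :
    v + m • cornerUnit 1 = ![v 0, v 1 + m] := by
  ext i; fin_cases i <;> simp [cornerUnit, nsmul_eq_mul]

/-- The real part of a difference of mesh points is bounded by their distance. [folklore] -/
theorem mul_abs_sub_le_dist_meshPoint_zero (δ : ℝ) (hδ : 0 ≤ δ) (v w : Site 2) :
    δ * |((w 0 : ℤ) : ℝ) - v 0| ≤ dist (meshPoint δ v) (meshPoint δ w) := by
  rw [Complex.dist_eq]
  refine le_trans ?_ (Complex.abs_re_le_norm _)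
  rw [Complex.sub_re, meshPoint_re, meshPoint_re, ← abs_of_nonneg hδ, ← abs_mul, abs_of_nonneg hδ]
  rw [show δ * v 0 - δ * w 0 = -(δ * ((w 0 : ℝ) - v 0)) by ring, abs_neg]

/-- The imaginary part of a difference of mesh points is bounded by their distance. [folklore] -/
theorem mul_abs_sub_le_dist_meshPoint_one (δ : ℝ) (hδ : 0 ≤ δ) (v w : Site 2) :
    δ * |((w 1 : ℤ) : ℝ) - v 1| ≤ dist (meshPoint δ v) (meshPoint δ w) := by
  rw [Complex.dist_eq]
  refine le_trans ?_ (Complex.abs_im_le_norm _)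
  rw [Complex.sub_im, meshPoint_im, meshPoint_im, ← abs_of_nonneg hδ, ← abs_mul, abs_of_nonneg hδ]
  rw [show δ * v 1 - δ * w 1 = -(δ * ((w 1 : ℝ) - v 1)) by ring, abs_neg]

/-- **Lipschitz bound from per-edge bounds.** If `‖g (u + e_k) - g u‖ ≤ L δ` for every site `u`
with mesh point in `B̄(z₀, r)` and every direction, then for all sites `v, w` with mesh points in
`B̄(z₀, r/2)`, `‖g v - g w‖ ≤ 2 L · dist (δ v, δ w)` (the `L`-shaped lattice path through the
corner `(w₀, v₁)` has `|v₀ - w₀| + |v₁ - w₁|` steps, all inside `B̄(z₀, r)`). [folklore] -/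
theorem norm_sub_le_of_latticeLipschitz {g : Site 2 → E} {δ r L : ℝ} (hδ : 0 < δ) {z₀ : ℂ}
    (hlip : ∀ u : Site 2, meshPoint δ u ∈ closedBall z₀ r → ∀ k : Fin 4,
      ‖g (u + cornerUnit k) - g u‖ ≤ L * δ)
    {v w : Site 2} (hv : meshPoint δ v ∈ closedBall z₀ (r / 2))
    (hw : meshPoint δ w ∈ closedBall z₀ (r / 2)) :
    ‖g v - g w‖ ≤ 2 * L * dist (meshPoint δ v) (meshPoint δ w) := by
  -- every site of the bounding box is in the big ball
  have hbox : ∀ u : Site 2, min (v 0) (w 0) ≤ u 0 → u 0 ≤ max (v 0) (w 0) →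
      min (v 1) (w 1) ≤ u 1 → u 1 ≤ max (v 1) (w 1) → meshPoint δ u ∈ closedBall z₀ r :=
    fun u h0 h0' h1 h1' => meshPoint_mem_closedBall_of_between hv hw h0 h0' h1 h1' hδ.le
  set c : Site 2 := ![w 0, v 1] with hc
  -- horizontal leg
  have hhor : ‖g v - g c‖ ≤ |((w 0 : ℤ) : ℝ) - v 0| * (L * δ) := by
    rcases le_total (v 0) (w 0) with hle | hle
    · obtain ⟨m, hmz⟩ : ∃ m : ℕ, (m : ℤ) = w 0 - v 0 := ⟨(w 0 - v 0).toNat, Int.toNat_of_nonneg (by omega)⟩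
      have hcv : c = v + m • cornerUnit 0 := by
        rw [add_nsmul_cornerUnit_zero_eq, hc]
        ext i; fin_cases i <;> (simp; try omega)
      have h := norm_sub_le_mul_of_steps (g := g) (L := L) (δ := δ) v 0 m (fun j hj => ?_)
      · rw [← hcv, norm_sub_rev] at h
        refine h.trans_eq ?_
        rw [show ((w 0 : ℤ) : ℝ) - v 0 = ((w 0 - v 0 : ℤ) : ℝ) by push_cast; ring, ← hmz]
        push_cast
        rw [Nat.abs_cast]
      · refine hlip _ (hbox _ ?_ ?_ ?_ ?_) 0 <;>
          simp only [add_nsmul_cornerUnit_zero_eq, Matrix.cons_val_zero, Matrix.cons_val_one] <;>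
          omega
    · obtain ⟨m, hmz⟩ : ∃ m : ℕ, (m : ℤ) = v 0 - w 0 := ⟨(v 0 - w 0).toNat, Int.toNat_of_nonneg (by omega)⟩
      have hvc : v = c + m • cornerUnit 0 := by
        rw [add_nsmul_cornerUnit_zero_eq, hc]
        ext i; fin_cases i <;> (simp; try omega)
      have h := norm_sub_le_mul_of_steps (g := g) (L := L) (δ := δ) c 0 m (fun j hj => ?_)
      · rw [← hvc] at h
        refine h.trans_eq ?_
        rw [show ((w 0 : ℤ) : ℝ) - v 0 = -((v 0 - w 0 : ℤ) : ℝ) by push_cast; ring, abs_neg, ← hmz]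
        push_cast
        rw [Nat.abs_cast]
      · refine hlip _ (hbox _ ?_ ?_ ?_ ?_) 0 <;>
          simp only [hc, add_nsmul_cornerUnit_zero_eq, Matrix.cons_val_zero, Matrix.cons_val_one] <;>
          omega
  -- vertical leg
  have hver : ‖g c - g w‖ ≤ |((w 1 : ℤ) : ℝ) - v 1| * (L * δ) := by
    rcases le_total (v 1) (w 1) with hle | hle
    · obtain ⟨m, hmz⟩ : ∃ m : ℕ, (m : ℤ) = w 1 - v 1 := ⟨(w 1 - v 1).toNat, Int.toNat_of_nonneg (by omega)⟩
      have hwc : w = c + m • cornerUnit 1 := by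
        rw [add_nsmul_cornerUnit_one_eq, hc]
        ext i; fin_cases i <;> (simp; try omega)
      have h := norm_sub_le_mul_of_steps (g := g) (L := L) (δ := δ) c 1 m (fun j hj => ?_)
      · rw [← hwc, norm_sub_rev] at h
        refine h.trans_eq ?_
        rw [show ((w 1 : ℤ) : ℝ) - v 1 = ((w 1 - v 1 : ℤ) : ℝ) by push_cast; ring, ← hmz]
        push_cast
        rw [Nat.abs_cast]
      · refine hlip _ (hbox _ ?_ ?_ ?_ ?_) 1 <;>
          simp only [hc, add_nsmul_cornerUnit_one_eq, Matrix.cons_val_zero, Matrix.cons_val_one] <;>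
          omega
    · obtain ⟨m, hmz⟩ : ∃ m : ℕ, (m : ℤ) = v 1 - w 1 := ⟨(v 1 - w 1).toNat, Int.toNat_of_nonneg (by omega)⟩
      have hcw : c = w + m • cornerUnit 1 := by
        rw [add_nsmul_cornerUnit_one_eq, hc]
        ext i; fin_cases i <;> (simp; try omega)
      have h := norm_sub_le_mul_of_steps (g := g) (L := L) (δ := δ) w 1 m (fun j hj => ?_)
      · rw [← hcw] at h
        refine h.trans_eq ?_
        rw [show ((w 1 : ℤ) : ℝ) - v 1 = -((v 1 - w 1 : ℤ) : ℝ) by push_cast; ring, abs_neg, ← hmz]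
        push_cast
        rw [Nat.abs_cast]
      · refine hlip _ (hbox _ ?_ ?_ ?_ ?_) 1 <;>
          simp only [add_nsmul_cornerUnit_one_eq, Matrix.cons_val_zero, Matrix.cons_val_one] <;>
          omega
  -- `L ≥ 0` (the ball contains the site `v`)
  have hL : 0 ≤ L * δ := by
    have hr : 0 ≤ r := by
      have := mem_closedBall.1 hv; linarith [dist_nonneg (x := meshPoint δ v) (y := z₀)]
    have hv' : meshPoint δ v ∈ closedBall z₀ r := closedBall_subset_closedBall (by linarith) hv
    exact (norm_nonneg _).trans (hlip v hv' 0)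
  have hL' : 0 ≤ L := by
    by_contra hneg
    push Not at hneg
    have : L * δ < 0 := mul_neg_of_neg_of_pos hneg hδ
    linarith
  have hsum : ‖g v - g w‖ ≤ (|((w 0 : ℤ) : ℝ) - v 0| + |((w 1 : ℤ) : ℝ) - v 1|) * (L * δ) := by
    calc ‖g v - g w‖ = ‖(g v - g c) + (g c - g w)‖ := by rw [sub_add_sub_cancel]
      _ ≤ ‖g v - g c‖ + ‖g c - g w‖ := norm_add_le _ _
      _ ≤ _ := by rw [add_mul]; exact add_le_add hhor hver
  have h0 := mul_abs_sub_le_dist_meshPoint_zero δ hδ.le v w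
  have h1 := mul_abs_sub_le_dist_meshPoint_one δ hδ.le v w
  calc ‖g v - g w‖ ≤ (|((w 0 : ℤ) : ℝ) - v 0| + |((w 1 : ℤ) : ℝ) - v 1|) * (L * δ) := hsum
    _ = L * (δ * |((w 0 : ℤ) : ℝ) - v 0| + δ * |((w 1 : ℤ) : ℝ) - v 1|) := by ring
    _ ≤ L * (dist (meshPoint δ v) (meshPoint δ w) + dist (meshPoint δ v) (meshPoint δ w)) := by
        gcongr
    _ = 2 * L * dist (meshPoint δ v) (meshPoint δ w) := by ring

end Literature.Probability.LatticeModels
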